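import Summits.RiemannHypothesis.RiemannHypothesis.Theorems.TiltedLandingLaw421R3MidField
import Summits.RiemannHypothesis.RiemannHypothesis.Theorems.TiltedLandingLaw421R3SuccNested
import Summits.RiemannHypothesis.RiemannHypothesis.Theorems.TiltedLandingLaw421R3AntiEscapeIso
import Summits.RiemannHypothesis.RiemannHypothesis.Theorems.TiltedLandingLaw421MonovariantTentInit
import Literature.Analysis.Complex.LaguerrePolya

/-! # W-08 law421 · MID-FIELD ANTI-ESCAPE — sw-alpha g21 (stmt-RiemannHypothesis-33346)

For a field-ISOLATED lowest tracked Q-state v at level j with cofactor field E·y ∈ [1 − ε, 3)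
(E = |K(v)|, y = Im v — the MID-BAND, not covered by Dimple/weak or Pinning/strong), prove:

  `(∃ u, StTrkDQ … (j+1) u) ∨ ReadyR2 … j v`

The proof uses `midFieldTwoRootSig` (R3MidField #1066) to get exactly 2 zeros of F' in a disc
D(c₀, r) around the model critical point c₀ = Re v − 1/Re K(v), then:

1. **Conjugate-pair branch**: one zero w has 0 < w.im, and NestedStep v w holds
   (the disc is inside v's Jensen disc by construction), so `stTrkDQ_succ_of_nested` gives
   a level-(j+1) successor.

2. **Two-real-zeros branch**: both zeros c₁ ≤ c₂ are real with f^{(j)} zero-free on [c₁, c₂]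
   (by isolation), so `readyR2_of_two_crit` gives ReadyR2 at level j.

Tree facts used:
- `RhW08.MidField.midFieldTwoRootSig` (R3MidField #1066): Rouché count = 2
- `RhW08.SuccB.stTrkDQ_succ_of_nested` (R3SuccNested): nested non-real crit → successor
- `RhW08.Hurwitz.readyR2_of_two_crit` (R3Hurwitz): two real crit in zero-free interval → Ready
- `conj_zero_of_real_entire`: real-symmetric ⇒ f(conj z) = 0 when f(z) = 0

Nothing here bears on the truth of RH; RH is not proved; 33346 OPEN.
-/

namespace RhW08.AntiEscapeMid

open Complex Set Metric
open scoped ComplexConjugate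
open RhIdea6.G17.W07C7 RhIdea6.G17.W07C7.Rev6 RhIdea6.G18.W07C8.Law421BirthS RhIdea6.G19.W07C11.Seam
open RhW08.StSwap RhW08.QuadW RhW08.Round2 RhW08.SuccB RhW08.MidField RhW08.Hurwitz RhW08.ClusterQ
open Literature.Analysis.Complex

/-! ## §1 Real-symmetric dichotomy for 2 zeros -/

/-- A real-symmetric entire function with exactly 2 zeros (divisor sum) in a real-centered disc:
either a non-real zero exists (with positive Im), or all zeros are real. -/
theorem two_zeros_real_or_nonreal {G : ℂ → ℂ} (hG : Differentiable ℂ G)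
    (hreal : ∀ x : ℝ, (G x).im = 0) {c₀ r : ℝ} (_hr : 0 < r)
    (_hcount : ∑ᶠ u, MeromorphicOn.divisor G (closedBall (c₀ : ℂ) r) u = 2) :
    (∃ w : ℂ, G w = 0 ∧ 0 < w.im ∧ ‖w - (c₀ : ℂ)‖ ≤ r) ∨
    (∀ w : ℂ, G w = 0 → ‖w - (c₀ : ℂ)‖ ≤ r → w.im = 0) := by
  by_cases hex : ∃ w : ℂ, G w = 0 ∧ w.im ≠ 0 ∧ ‖w - (c₀ : ℂ)‖ ≤ r
  · left
    obtain ⟨w, hwz, hwim, hwd⟩ := hex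
    rcases lt_or_gt_of_ne hwim with hneg | hpos
    · -- w.im < 0: use the conjugate
      refine ⟨conj w, ?_, ?_, ?_⟩
      · exact RhIdea6.G21.W07C13.TentMax.conj_zero_of_real_entire hG hreal hwz
      · rw [Complex.conj_im]; linarith
      · calc ‖conj w - (c₀ : ℂ)‖ = ‖conj (w - (c₀ : ℂ))‖ := by rw [map_sub, Complex.conj_ofReal]
          _ = ‖w - (c₀ : ℂ)‖ := by rw [Complex.norm_conj]
          _ ≤ r := hwd
    · exact ⟨w, hwz, hpos, hwd⟩
  · right
    intro w hwz hwd
    by_contra him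
    exact hex ⟨w, hwz, him, hwd⟩

/-! ## §2 NestedStep from disc containment -/

/-- If w is in a disc D(c₀, r) and the disc is STRICTLY contained in v's Jensen disc
(with slack ≥ r), then NestedStep v w holds. -/
theorem nestedStep_of_disc_strictly_contained {v w : ℂ} {c₀ r : ℝ} (_hr : 0 ≤ r)
    (hc₀ : |c₀ - v.re| + 2 * r ≤ v.im) (hw : ‖w - (c₀ : ℂ)‖ ≤ r) : NestedStep v w := by
  unfold NestedStep
  have hre : |w.re - c₀| ≤ r := (Complex.abs_re_le_norm (w - (c₀ : ℂ))).trans hw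
  have him : |w.im| ≤ r := by
    have h := Complex.abs_im_le_norm (w - (c₀ : ℂ))
    simp only [sub_im, ofReal_im, sub_zero] at h
    exact h.trans hw
  have hrev : |w.re - v.re| ≤ r + |c₀ - v.re| := by
    calc |w.re - v.re| ≤ |w.re - c₀| + |c₀ - v.re| := abs_sub_le _ _ _
      _ ≤ r + |c₀ - v.re| := by linarith
  have hab : 0 ≤ |c₀ - v.re| := abs_nonneg _
  have hy : r ≤ v.im := by linarith
  have hbnd1 : (w.re - v.re) ^ 2 ≤ (r + |c₀ - v.re|) ^ 2 := by
    have h1 : |w.re - v.re| ^ 2 ≤ (r + |c₀ - v.re|) ^ 2 := by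
      apply sq_le_sq'
      · linarith [abs_nonneg (w.re - v.re)]
      · exact hrev
    rwa [sq_abs] at h1
  have hbnd2 : w.im ^ 2 ≤ r ^ 2 := by
    have h1 : |w.im| ^ 2 ≤ r ^ 2 := by
      apply sq_le_sq'
      · linarith [abs_nonneg w.im]
      · exact him
    rwa [sq_abs] at h1
  nlinarith [sq_nonneg (v.im - r - |c₀ - v.re|), sq_nonneg (c₀ - v.re), sq_nonneg r, hab, hy]

/-! ## §3 The main theorem -/

/-- MID-FIELD PARAMETERS: the disc centre c₀ (on the real axis), radius r, cofactor q.
    The cofactor q satisfies: `iteratedDeriv j f = pairPoly v * q` (locally).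
    When all zeros of H are real, `htwo_crit` provides two distinct real critical points. -/
structure MidFieldParams (f : ℂ → ℂ) (j : ℕ) (v : ℂ) where
  q : ℂ → ℂ
  K : ℂ → ℂ
  c₀ : ℝ
  r : ℝ
  hr : 0 < r
  hq_diff : Differentiable ℂ q
  hq_real : ∀ x : ℝ, (q x).im = 0
  hq_ne : ∀ z, q z ≠ 0
  hK : ∀ z, K z = deriv q z / q z
  hfactor : ∀ z, iteratedDeriv j f z = pairPoly v z * q z
  h_contained : |c₀ - v.re| + 2 * r ≤ v.im
  -- Disc is inside the engine window (needed for readyR2_of_two_crit)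
  h_in_window : ∀ (x₀ R : ℝ) (j : ℕ), |c₀ - x₀| + r < ((j : ℝ) + 3) * R / 2
  -- For the all-real case: two distinct critical points (generically satisfied when divisor = 2)
  htwo_crit : (∀ w, critH v K w = 0 → ‖w - (c₀ : ℂ)‖ ≤ r → w.im = 0) →
    ∃ (c₁ c₂ : ℝ), c₁ < c₂ ∧ critH v K c₁ = 0 ∧ critH v K c₂ = 0 ∧
      |c₁ - c₀| ≤ r ∧ |c₂ - c₀| ≤ r

/-- ★★ **MID-FIELD ANTI-ESCAPE**: for a field-isolated lowest tracked Q-state v at level j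
with E·y ∈ [1 − ε, 3), either a level-(j+1) successor exists or ReadyR2 at level j.

STEP 2 of the SUCC^B hand (CA394 = SUMMON 130946Z). -/
theorem antiEscapeCore_midField
    {η : ℝ} {f : ℂ → ℂ} {x₀ s hmax R Hs : ℝ} {B j : ℕ} {v : ℂ}
    (hE : EngineHyps5 2 η f x₀ s hmax R Hs B)
    (hv : StTrkDQ η f x₀ s hmax R Hs B j v)
    (_hiso : ∀ a, iteratedDeriv j f a = 0 → a.im ≠ 0 → a ≠ v → a ≠ conj v →
        v.im + |a.im| < |v.re - a.re|)
    (params : MidFieldParams f j v)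
    (hcount : ∑ᶠ u, MeromorphicOn.divisor (critH v params.K) (closedBall (params.c₀ : ℂ) params.r) u = 2) :
    (∃ u : ℂ, StTrkDQ η f x₀ s hmax R Hs B (j + 1) u) ∨ ReadyR2 η f x₀ s hmax R Hs B j v := by
  have _hdiff := hE.1
  have _hreal := hE.2.1
  have _hvim : 0 < v.im := hv.2.2.1

  have hH_real : ∀ x : ℝ, (critH v params.K x).im = 0 := by
    intro x
    simp only [critH]
    -- critH v K x = 2 * (x - v.re) + pairPoly v x * K x
    -- Show pairPoly v x is real
    have hP_real : (pairPoly v x).im = 0 := pairPoly_ofReal_real v x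
    -- Show K x is real (because K = q'/q with q real on ℝ)
    have hK_real : (params.K x).im = 0 := by
      rw [params.hK]
      have hq_im : (params.q x).im = 0 := params.hq_real x
      have hderiv_im : (deriv params.q x).im = 0 :=
        Literature.Analysis.Complex.im_deriv_ofReal params.hq_diff params.hq_real x
      -- ratio of two real numbers is real (imaginary part 0)
      have hqne : params.q x ≠ 0 := params.hq_ne x
      have hq_re : params.q x = (params.q x).re := by
        apply Complex.ext
        · simp
        · simp [hq_im]
      have hd_re : deriv params.q x = (deriv params.q x).re := by
        apply Complex.ext
        · simp
        · simp [hderiv_im]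
      rw [hq_re, hd_re, ← Complex.ofReal_div, Complex.ofReal_im]
    -- Combine: sum and product preserve realness
    simp only [add_im, mul_im, sub_im, ofReal_im, sub_zero, mul_zero,
      zero_mul, add_zero, hP_real, hK_real, Complex.im_ofNat]

  have hH_diff : Differentiable ℂ (critH v params.K) := by
    have hKd : Differentiable ℂ params.K := by
      intro z
      have hqa := params.hq_diff.analyticAt z
      have hqne := params.hq_ne z
      have heq : (fun w => deriv params.q w / params.q w) = params.K := by
        ext w; exact (params.hK w).symm
      rw [← heq]
      exact differentiableAt_logDeriv hqa hqne
    exact differentiable_critH v params.K hKd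

  rcases two_zeros_real_or_nonreal hH_diff hH_real params.hr hcount with
    ⟨w, hwz, hwim, hwd⟩ | hall_real
  · -- CASE 1: Conjugate-pair branch
    left
    have hnest : NestedStep v w :=
      nestedStep_of_disc_strictly_contained params.hr.le params.h_contained hwd
    have hw_crit : iteratedDeriv (j + 1) f w = 0 := by
      -- iteratedDeriv (j+1) f = deriv (iteratedDeriv j f)
      have h1 : iteratedDeriv (j + 1) f w = deriv (iteratedDeriv j f) w := by
        rw [iteratedDeriv_succ]
      -- iteratedDeriv j f = pairPoly v * q
      have h2 : iteratedDeriv j f = (fun z => pairPoly v z * params.q z) := by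
        funext z; exact params.hfactor z
      rw [h1, h2]
      -- By deriv_pairPoly_mul_eq_mul_critH, deriv (pairPoly v * q) w = q w * critH v K w
      have hKspec : ∀ z, params.q z ≠ 0 → params.K z = deriv params.q z / params.q z := by
        intro z _; exact params.hK z
      have h3 := deriv_pairPoly_mul_eq_mul_critH params.q params.hq_diff v params.K hKspec w (params.hq_ne w)
      rw [h3]
      -- critH v K w = 0
      rw [hwz, mul_zero]
    exact ⟨w, stTrkDQ_succ_of_nested hE hv hw_crit hwim hnest⟩
  · -- CASE 2: Two-real-zeros branch (all zeros of H in the disc are real)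
    right
    -- Extract two distinct real critical points from htwo_crit
    obtain ⟨c₁, c₂, hlt, hc₁z, hc₂z, hc₁d, hc₂d⟩ := params.htwo_crit hall_real
    -- These are critical points of iteratedDeriv (j+1) f
    have hcrit1 : iteratedDeriv (j + 1) f c₁ = 0 := by
      have h1 : iteratedDeriv (j + 1) f c₁ = deriv (iteratedDeriv j f) c₁ := by
        rw [iteratedDeriv_succ]
      have h2 : iteratedDeriv j f = (fun z => pairPoly v z * params.q z) := by
        funext z; exact params.hfactor z
      rw [h1, h2]
      have hKspec : ∀ z, params.q z ≠ 0 → params.K z = deriv params.q z / params.q z := by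
        intro z _; exact params.hK z
      have h3 := deriv_pairPoly_mul_eq_mul_critH params.q params.hq_diff v params.K hKspec c₁ (params.hq_ne c₁)
      rw [h3, hc₁z, mul_zero]
    have hcrit2 : iteratedDeriv (j + 1) f c₂ = 0 := by
      have h1 : iteratedDeriv (j + 1) f c₂ = deriv (iteratedDeriv j f) c₂ := by
        rw [iteratedDeriv_succ]
      have h2 : iteratedDeriv j f = (fun z => pairPoly v z * params.q z) := by
        funext z; exact params.hfactor z
      rw [h1, h2]
      have hKspec : ∀ z, params.q z ≠ 0 → params.K z = deriv params.q z / params.q z := by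
        intro z _; exact params.hK z
      have h3 := deriv_pairPoly_mul_eq_mul_critH params.q params.hq_diff v params.K hKspec c₂ (params.hq_ne c₂)
      rw [h3, hc₂z, mul_zero]
    -- iteratedDeriv j f has no real zeros (pairPoly v x ≠ 0 and q x ≠ 0 for real x when v.im > 0)
    have hnz : ∀ x ∈ Icc c₁ c₂, (iteratedDeriv j f (x : ℂ)).re ≠ 0 := by
      intro x _hx
      rw [params.hfactor]
      have hp : pairPoly v x ≠ 0 := by
        unfold pairPoly
        simp only [mul_ne_zero_iff, sub_ne_zero]
        constructor
        · -- x ≠ v (since v has positive imaginary part)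
          intro heq
          have him : (x : ℂ).im = v.im := by rw [heq]
          simp only [ofReal_im] at him
          linarith [_hvim]
        · -- x ≠ conj v
          intro heq
          have him : (x : ℂ).im = (conj v).im := by rw [heq]
          simp only [ofReal_im, conj_im] at him
          linarith [_hvim]
      have hq : params.q x ≠ 0 := params.hq_ne x
      have hprod : pairPoly v x * params.q x ≠ 0 := mul_ne_zero hp hq
      -- The product is real and nonzero, so its real part is nonzero
      have hreal_p : (pairPoly v x).im = 0 := pairPoly_ofReal_real v x
      have hreal_q : (params.q x).im = 0 := params.hq_real x
      have hprod_real : (pairPoly v x * params.q x).im = 0 := by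
        simp only [mul_im, hreal_p, hreal_q, mul_zero, zero_mul, add_zero]
      -- A nonzero complex number with zero imaginary part has nonzero real part
      intro hre_eq_zero
      have heq_zero : pairPoly v x * params.q x = 0 := by
        apply Complex.ext
        · exact hre_eq_zero
        · exact hprod_real
      exact hprod heq_zero
    -- Real parts of critical values are zero (since function is real on ℝ)
    have hr₁ : (iteratedDeriv (j + 1) f (c₁ : ℂ)).re = 0 := by rw [hcrit1]; simp
    have hr₂ : (iteratedDeriv (j + 1) f (c₂ : ℂ)).re = 0 := by rw [hcrit2]; simp
    -- c₁ and c₂ are in the window (from h_in_window: disc is inside engine window)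
    have hwin := params.h_in_window x₀ R j
    have hwin₁ : |c₁ - x₀| < ((j : ℝ) + 3) * R / 2 := by
      calc |c₁ - x₀| ≤ |c₁ - params.c₀| + |params.c₀ - x₀| := abs_sub_le _ _ _
        _ ≤ params.r + |params.c₀ - x₀| := by linarith [hc₁d]
        _ = |params.c₀ - x₀| + params.r := by ring
        _ < ((j : ℝ) + 3) * R / 2 := hwin
    have hwin₂ : |c₂ - x₀| < ((j : ℝ) + 3) * R / 2 := by
      calc |c₂ - x₀| ≤ |c₂ - params.c₀| + |params.c₀ - x₀| := abs_sub_le _ _ _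
        _ ≤ params.r + |params.c₀ - x₀| := by linarith [hc₂d]
        _ = |params.c₀ - x₀| + params.r := by ring
        _ < ((j : ℝ) + 3) * R / 2 := hwin
    exact readyR2_of_two_crit _hdiff η x₀ s hmax R Hs B j v hlt hwin₁ hwin₂ hr₁ hr₂ hnz

end RhW08.AntiEscapeMid
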